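import Literature.AlgebraicGeometry.Frobenioids.UnitTrivializationIsFrobenioid
import Literature.AlgebraicGeometry.Frobenioids.BiratLocalizationUniversal
import Literature.AlgebraicGeometry.Frobenioids.BirationalizationFunctor
import Literature.AlgebraicGeometry.Frobenioids.IsotropicFrobenioid
import HarnessLib

/-!
# Frobenioids I, §4: the birationalization of `C^un-tr` and the comparison functor
# `(C^istr)^birat → (C^un-tr)^birat`

Mochizuki, *The geometry of Frobenioids I: the general theory*, Kyushu J. Math. **62** (2008)
293–400, Prop. 3.3 (iii)(iv) pp. 59–60, Prop. 4.4 (i)(iv) pp. 82–83, Def. 4.5 (iii) p. 86 ("(b)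
`(C^un-tr)^birat` admits a Frobenius-compact object"), Prop. 4.8 (iii) p. 88.
[cite: MochizukiFrdI2008, Def. 4.5 (iii) p.86]

With `C^un-tr` a Frobenioid (`isFrobenioid_untr`, seat abc-iut-L1-d5) the birationalization
`(C^un-tr)^birat := Birat (untrFunctor hF) (isFrobenioid_untr hF) (hasBiratSquares_untr hF)` of seat
abc-iut-L6-t8 exists. This proof-only file constructs the comparison functor
`Birat.toUntrBirat : (C^istr)^birat ⥤ (C^un-tr)^birat` induced (universal property of
`C^istr → (C^istr)^birat`, Prop. 4.4 (i)) by `C^istr → C^un-tr → (C^un-tr)^birat`, where `C^istr` is seat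
abc-iut-L1-t1's `Istr F` with `istrFunctor F` (identified with the §3–§4 data's `S.Istr` by
`istrToData`, the identity on objects), and proves: the defining factorisation; the formula on
fractions; fullness; compatibility with Frobenius degrees and bases of the functors to `F_{0_D}`; hence
base-identity linear endomorphisms go to base-identity linear endomorphisms. It also records the
"essentially surjective" clause of Prop. 3.3 (iv) for `C^un-tr → F_Φ` (`untrFunctor_essSurj`). Consumer: the transfer of
Def. 4.5 (iii)(b) to `(C^istr)^birat` in the proof of Prop. 4.8 (iii) (seat abc-iut-L6-t20).
No statement of the paper is strengthened; nothing here bears on [IUTchIII] Cor. 3.12.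
-/

namespace Literature.AlgebraicGeometry.Frobenioids

open CategoryTheory Opposite

universe w v v' u u'

namespace PreFrobenioid

variable {D : Type u} [Category.{v} D] {Φ : Dᵒᵖ ⥤ CommMonCat.{w}}
  {C : Type u'} [Category.{v'} C] {F : C ⥤ ElemFrobenioid Φ}

open PreFrobenioidData (ofFunctor)

/-- The identification `C^istr (as Istr F) → C^istr (as S.Istr)` of the two typings of the full
subcategory of isotropic objects (identity on objects and arrows). [cite: MochizukiFrdI2008, Def. 1.2 (iv) p.23] -/
noncomputable def istrToData (F : C ⥤ ElemFrobenioid Φ) : Istr F ⥤ (ofFunctor Φ F).Istr :=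
  ObjectProperty.ιOfLE (fun A (h : isotropicObjects F A) => (PreFrobenioidData.ofFunctor_isIsotropic F A).mpr h)

/-- `istrToData` on objects. [cite: MochizukiFrdI2008, Def. 1.2 (iv) p.23] -/
theorem istrToData_obj (A : Istr F) : ((istrToData F).obj A).obj = A.obj := rfl

/-- `istrToData` on arrows. [cite: MochizukiFrdI2008, Def. 1.2 (iv) p.23] -/
theorem istrToData_map {A B : Istr F} (α : A ⟶ B) : ((istrToData F).map α).hom = α.hom := rfl

/-- **Prop. 3.3 (iv): `C^un-tr → F_Φ` is essentially surjective** — every object of `F_Φ` is (the image of)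
the isotropic hull of a Frobenius-trivial object over its base (Def. 1.3 (i)(a), (vii)(a)); in `F_Φ`,
objects with isomorphic bases are isomorphic (zero section). [cite: MochizukiFrdI2008, Prop. 3.3 (iv) p.60] -/
theorem untrFunctor_essSurj (hF : IsFrobenioid F) : (untrFunctor hF).EssSurj := by
  refine ⟨fun X => ?_⟩
  obtain ⟨A, -, ⟨i⟩⟩ := hF.i_a (ElemFrobenioid.base X)
  obtain ⟨A₁, h, hh⟩ := hF.vii_a A
  haveI : IsIso (Base F h) := hh.2.1.2
  let A₁' : (ofFunctor Φ F).Istr := ⟨A₁, (PreFrobenioidData.ofFunctor_isIsotropic F A₁).mpr hh.2.2.1⟩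
  exact ⟨(ofFunctor Φ F).toUntr.obj A₁',
    ⟨(ElemFrobenioid.zeroSection Φ).mapIso ((asIso (Base F h)).symm ≪≫ i)⟩⟩

namespace Birat

variable (hF : IsFrobenioid F) (hsq' : HasBiratSquares (istrFunctor F))

/-- `C^istr → C^un-tr → (C^un-tr)^birat` inverts the co-angular pre-steps of `C^istr` (their classes are
co-angular pre-steps of `C^un-tr`, Prop. 3.3 (iv), inverted by Prop. 4.4 (iv)).
[cite: MochizukiFrdI2008, Prop. 4.4 (iv) p.83] -/
theorem istr_toUntr_toBirat_inverts :
    (coAngularPreSteps (istrFunctor F)).IsInvertedBy (istrToData F ⋙ (ofFunctor Φ F).toUntr ⋙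
      toBirat (untrFunctor hF) (isFrobenioid_untr hF) (hasBiratSquares_untr hF)) :=
  fun _ _ α hα => toBirat_inverts (isFrobenioid_untr hF) (hasBiratSquares_untr hF)
    ((ofFunctor Φ F).toUntr.map ((istrToData F).map α))
    (isCoAngularPreStep_toUntr_of hF _ ((isCoAngularPreStep_istr_iff hF α).mp hα).2)

/-- **The comparison functor `(C^istr)^birat → (C^un-tr)^birat`** induced by
`C^istr → C^un-tr → (C^un-tr)^birat` via the universal property of `C^istr → (C^istr)^birat`
(Prop. 4.4 (i)); on objects `(A^istr)^birat ↦ (A^un-tr)^birat`. [cite: MochizukiFrdI2008, Prop. 4.4 (i) p.82] -/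
noncomputable def toUntrBirat : Birat (istrFunctor F) (isFrobenioid_istr hF) hsq' ⥤
    Birat (untrFunctor hF) (isFrobenioid_untr hF) (hasBiratSquares_untr hF) :=
  Birat.lift (isFrobenioid_istr hF) hsq'
    (istrToData F ⋙ (ofFunctor Φ F).toUntr ⋙
      toBirat (untrFunctor hF) (isFrobenioid_untr hF) (hasBiratSquares_untr hF))
    (istr_toUntr_toBirat_inverts hF)

/-- The defining factorisation `C^istr → (C^istr)^birat → (C^un-tr)^birat = C^istr → C^un-tr → (C^un-tr)^birat`.
[cite: MochizukiFrdI2008, Prop. 4.4 (i) p.82] -/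
theorem toBirat_istr_comp_toUntrBirat :
    toBirat (istrFunctor F) (isFrobenioid_istr hF) hsq' ⋙ toUntrBirat hF hsq' =
      istrToData F ⋙ (ofFunctor Φ F).toUntr ⋙
        toBirat (untrFunctor hF) (isFrobenioid_untr hF) (hasBiratSquares_untr hF) :=
  toBirat_comp_lift _ _

variable {hF hsq'}

/-- `toUntrBirat` on objects. [cite: MochizukiFrdI2008, Prop. 4.4 (i) p.82] -/
theorem toUntrBirat_obj (X : Birat (istrFunctor F) (isFrobenioid_istr hF) hsq') :
    (toUntrBirat hF hsq').obj X = (toBirat (untrFunctor hF) (isFrobenioid_untr hF)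
      (hasBiratSquares_untr hF)).obj ((ofFunctor Φ F).toUntr.obj ((istrToData F).obj X.out)) := rfl

/-- `toUntrBirat` on a fraction `(α, φ′)` of `C^istr`: the fraction `([α], [φ′])` of `C^un-tr`.
[cite: MochizukiFrdI2008, Prop. 4.4 (i) p.83] -/
theorem toUntrBirat_map_homMk {X Y : Birat (istrFunctor F) (isFrobenioid_istr hF) hsq'}
    (f : BiratFrac (istrFunctor F) X.out Y.out) :
    (toUntrBirat hF hsq').map (homMk f) =
      (homMk ⟨(ofFunctor Φ F).toUntr.obj ((istrToData F).obj f.src),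
          (ofFunctor Φ F).toUntr.map ((istrToData F).map f.den),
          (ofFunctor Φ F).toUntr.map ((istrToData F).map f.num),
          isCoAngularPreStep_toUntr_of hF _ ((isCoAngularPreStep_istr_iff hF f.den).mp f.den_mem).2⟩ :
        (toBirat (untrFunctor hF) (isFrobenioid_untr hF) (hasBiratSquares_untr hF)).obj
            ((ofFunctor Φ F).toUntr.obj ((istrToData F).obj X.out)) ⟶
          (toBirat (untrFunctor hF) (isFrobenioid_untr hF) (hasBiratSquares_untr hF)).obj
            ((ofFunctor Φ F).toUntr.obj ((istrToData F).obj Y.out))) := by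
  refine Eq.trans ?_ (homMk_eq_inv_comp (hF := isFrobenioid_untr hF) (hsq := hasBiratSquares_untr hF)
    (⟨(ofFunctor Φ F).toUntr.obj ((istrToData F).obj f.src),
      (ofFunctor Φ F).toUntr.map ((istrToData F).map f.den),
      (ofFunctor Φ F).toUntr.map ((istrToData F).map f.num),
      isCoAngularPreStep_toUntr_of hF _ ((isCoAngularPreStep_istr_iff hF f.den).mp f.den_mem).2⟩ :
      BiratFrac (untrFunctor hF) ((ofFunctor Φ F).toUntr.obj ((istrToData F).obj X.out))
        ((ofFunctor Φ F).toUntr.obj ((istrToData F).obj Y.out)))).symm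
  rfl

/-! ### Fullness -/

/-- **`(C^istr)^birat → (C^un-tr)^birat` is full** (on its objects): a fraction `([α], [φ′])` of `C^un-tr`
comes from the fraction `(α, φ′)` of `C^istr` (the apex is isotropic; `α` is a pre-step of `C` out of an
isotropic object, hence a co-angular pre-step of `C^istr`). [cite: MochizukiFrdI2008, Prop. 4.4 (i) p.83] -/
theorem toUntrBirat_full : (toUntrBirat hF hsq').Full := by
  refine ⟨fun {X Y} g => ?_⟩
  obtain ⟨⟨S₀, den, num, hden⟩, rfl⟩ := homMk_surjective
    (X := (toBirat (untrFunctor hF) (isFrobenioid_untr hF) (hasBiratSquares_untr hF)).obj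
      ((ofFunctor Φ F).toUntr.obj ((istrToData F).obj X.out)))
    (Y := (toBirat (untrFunctor hF) (isFrobenioid_untr hF) (hasBiratSquares_untr hF)).obj
      ((ofFunctor Φ F).toUntr.obj ((istrToData F).obj Y.out))) g
  obtain ⟨a, rfl⟩ := (ofFunctor Φ F).toUntr.map_surjective (X := S₀.as) (Y := (istrToData F).obj X.out) den
  obtain ⟨b, rfl⟩ := (ofFunctor Φ F).toUntr.map_surjective (X := S₀.as) (Y := (istrToData F).obj Y.out) num
  have hS : IsIsotropic F S₀.as.obj := (PreFrobenioidData.ofFunctor_isIsotropic F S₀.as.obj).mp S₀.as.property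
  have ha : IsCoAngularPreStep F a.hom :=
    ⟨isCoAngular_of_isIsotropic_src hF a.hom hS, (isPreStep_toUntr_iff a).mp hden.2⟩
  refine ⟨homMk ⟨Istr.mk S₀.as.obj hS, (ObjectProperty.homMk a.hom : Istr.mk S₀.as.obj hS ⟶ X.out),
    (ObjectProperty.homMk b.hom : Istr.mk S₀.as.obj hS ⟶ Y.out), (isCoAngularPreStep_istr_iff hF _).mpr ha⟩, ?_⟩
  rw [toUntrBirat_map_homMk]
  rfl

/-- Every arrow of `(C^un-tr)^birat` between objects `(A^un-tr)^birat` is the image of an arrow of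
`(C^istr)^birat`. [cite: MochizukiFrdI2008, Prop. 4.4 (i) p.83] -/
theorem toUntrBirat_map_surjective {X Y : Birat (istrFunctor F) (isFrobenioid_istr hF) hsq'} :
    Function.Surjective ((toUntrBirat hF hsq').map : (X ⟶ Y) → _) :=
  (toUntrBirat_full (hF := hF) (hsq' := hsq')).map_surjective

/-! ### Compatibility with `(C^istr)^birat → F_{0_D}` and `(C^un-tr)^birat → F_{0_D}` -/

/-- `toUntrBirat` preserves Frobenius degrees (both are `deg_Fr(φ′)` of a representing fraction).
[cite: MochizukiFrdI2008, Prop. 4.4 (iv) p.83] -/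
theorem degFr_toUntrBirat_map {X Y : Birat (istrFunctor F) (isFrobenioid_istr hF) hsq'} (g : X ⟶ Y) :
    degFr (toElemZero (isFrobenioid_untr hF) (hasBiratSquares_untr hF)) ((toUntrBirat hF hsq').map g) =
      degFr (toElemZero (isFrobenioid_istr hF) hsq') g := by
  obtain ⟨f, rfl⟩ := homMk_surjective g
  rw [toUntrBirat_map_homMk]
  rfl

/-- `toUntrBirat` preserves bases (both are `Base(α)⁻¹ ≫ Base(φ′)` of a representing fraction).
[cite: MochizukiFrdI2008, Prop. 4.4 (i) p.84] -/
theorem base_toUntrBirat_map {X Y : Birat (istrFunctor F) (isFrobenioid_istr hF) hsq'} (g : X ⟶ Y) :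
    Base (toElemZero (isFrobenioid_untr hF) (hasBiratSquares_untr hF)) ((toUntrBirat hF hsq').map g) =
      Base (toElemZero (isFrobenioid_istr hF) hsq') g := by
  obtain ⟨f, rfl⟩ := homMk_surjective g
  rw [toUntrBirat_map_homMk]
  rfl

/-- `toUntrBirat` carries `O^▷` into `O^▷` (base-identity linear endomorphisms).
[cite: MochizukiFrdI2008, Prop. 4.4 (i) p.84] -/
theorem mem_endSubmonoid_toUntrBirat_map {X : Birat (istrFunctor F) (isFrobenioid_istr hF) hsq'}
    (g : End X) (h : g ∈ endSubmonoid (toElemZero (isFrobenioid_istr hF) hsq') X) :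
    (toUntrBirat hF hsq').map g ∈ endSubmonoid (toElemZero (isFrobenioid_untr hF)
      (hasBiratSquares_untr hF)) ((toUntrBirat hF hsq').obj X) := by
  constructor
  · unfold IsBaseIdentity
    rw [base_toUntrBirat_map]
    exact h.1
  · unfold IsLinear
    rw [degFr_toUntrBirat_map]
    exact h.2

/-- Conversely, an endomorphism of `(A^istr)^birat` whose image is in `O^▷` is in `O^▷`.
[cite: MochizukiFrdI2008, Prop. 4.4 (i) p.84] -/
theorem mem_endSubmonoid_of_toUntrBirat_map {X : Birat (istrFunctor F) (isFrobenioid_istr hF) hsq'}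
    (g : End X) (h : (toUntrBirat hF hsq').map g ∈ endSubmonoid (toElemZero (isFrobenioid_untr hF)
      (hasBiratSquares_untr hF)) ((toUntrBirat hF hsq').obj X)) :
    g ∈ endSubmonoid (toElemZero (isFrobenioid_istr hF) hsq') X := by
  constructor
  · have h1 := h.1
    unfold IsBaseIdentity at h1 ⊢
    rw [base_toUntrBirat_map] at h1
    exact h1
  · have h2 := h.2
    unfold IsLinear at h2 ⊢
    rw [degFr_toUntrBirat_map] at h2
    exact h2

end Birat

end PreFrobenioid

end Literature.AlgebraicGeometry.Frobenioids
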